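import Mathlib
import Literature.NumberTheory.LFunctions.Zhang2022.Section17NuStarBound
import Literature.NumberTheory.LFunctions.Zhang2022.Section17Phi3plusTermByTerm
import Literature.NumberTheory.LFunctions.Zhang2022.Section17NuStarSizes
import HarnessLib

/-!
# Zhang (2022) §17 (17.3) `Φ₃⁺(p) = pΣ_{n<D⁴}ν*(n)ν(n)/n + o(p)` is a THEOREM of the tree:
# assembly of the term-by-term step, the off-diagonal bound, the diagonal count and the sizes

Topic `Literature/NumberTheory/LFunctions/Zhang2022` (Landau–Siegel audit tree; verdict-neutral).
Y. Zhang, *Discrete mean estimates and the Landau–Siegel zero*, arXiv:2211.02515v1 (2022)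
[Zhang2022LandauSiegel] — **an unrefereed manuscript under adjudication** (cell siegel-zhang, D-0069).
§17 p. 96 [tex L4715–L4728; DAG `Z22:§17.u003`–`Z22:(17.3)`]:

> `Φ₃⁺(p) = Σ*_{ψ (mod p)} (1/2πi)∫_{𝔍(1)} 𝔨₃(s,ψ)ω(s)ds`. For `σ > 1` we can write … `= Σ_m ν*(m)ψ(m)m^{−s}`.
> Thus, replacing the segment `𝔍(1)` by the line `σ = 3/2` and integrating term by term give
> `Φ₃⁺(p) = Σ_mΣ_{n<D⁴} … + O(ε)`. By trivial estimation, the contribution from the terms with `m ≠ n`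
> above is `o(p)`. Hence `Φ₃⁺(p) = pΣ_{n<D⁴} ν*(n)ν(n)/n + o(p)`. (17.3)

This file proves **(17.3) as typed by the cell, `Typed.Section17.Eq17_3 c′`, UNCONDITIONALLY**
(`eq17_3_holds`), for every `c′`, by assembling tree theorems:

* the term-by-term display with explicit error, in the derivable range `1 ≤ n ≤ D⁴` (the range of
  `F(1−s,ψ̄) = Skeleton.FpolyBar`; the print's `n < D⁴` is one term short):
  `Phi3TermByTerm.norm_Phi3plus_sub_tsum_le` (sz-d54; with `Typed.Section17.step17_u004_holds`,
  `SmoothWeightMellin`, `SmoothWeightSegmentTail`);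
* "the terms with `m ≠ n`": `Phi3TermByTerm.norm_offDiagonal_term_u005_le` (sz-d54, on
  `SmoothWeight.norm_offDiagonal_le` and primitive-character orthogonality);
* the diagonal `= #Σ*_{ψ (mod p)}·ν*(n)ν(n)/n`, `#Σ* = p − 2`: `Phi3TermByTerm.term_u005_diag`,
  `Phi3TermByTerm.card_chrMod`;
* the sizes: `|ν*(n)| ≤ Cn^{1/4}` (`Phi3Eval.nuStar_bound`), `Σ_m|ν*(m)|m^{−3/2} ≤ CΣm^{−5/4}`,
  `|Σ_{n<D⁴}ν*(n)ν(n)/n| ≤ CD⁵`, `Σ_{n≤D⁴}|ν(n)|√n ≤ D¹⁰`, `poly(D) = o(P)`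
  (`Section17Eq173Sizes`, `Section17NuStarSizes`);

and the bookkeeping proper to this file: the split of the double sum (`tsum_eq_diag_add_offdiag`),
`e^{(1−𝓛₁²)/(4𝓛₂²)} ≤ e^{−𝓛⁹} = P⁻¹` (`𝓛 ≥ 5`), and the extra diagonal term at `n = D⁴`,
`(p−2)ν*(D⁴)ν(D⁴)/D⁴ = O(p·D^{−2}) = o(p)` (divisor bound `τ₂(D⁴) ≪ D`), so that the PRINTED range
`n < D⁴` of (17.3) is what is concluded. CONSEQUENCE for the cell's DAG: `Z22:(17.3)` = discharged;
`Z22:§17.u005` = discharged in the `n ≤ D⁴` reading with explicit error (d54); the inline "`m ≠ n`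
terms are `o(p)`" = discharged (`Phi3Eval.claim17_offdiag_holds`). (17.3) is not an input of
`Ded1710` (u007 restates it with replaced coefficients — "a detailed analysis shows", still CLAIM).
WHAT THIS IS NOT: a proof of u007/(17.5) or of (17.10); any claim about Theorems 1–2 of the source
or about Landau–Siegel zeros; nothing here bears on the cell's verdict on (8.24).

## References

* Y. Zhang, arXiv:2211.02515v1 (2022), §17 p. 96, (17.3). [cite: Zhang2022LandauSiegel, §17 (17.3)]
-/

noncomputable section

open Complex Real ComplexConjugate Finset
open Literature.NumberTheory.LFunctions.Zhang2022.Skeleton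
open Literature.NumberTheory.LFunctions.Zhang2022.Typed.Section17

namespace Literature.NumberTheory.LFunctions.Zhang2022.Phi3Eval

/-! ## Bookkeeping lemmas -/

section Book

/-- The split of an absolutely summable double sum `Σ_m Σ_{n∈S} T(m,n)` into its diagonal
`Σ_{n∈S} T(n,n)` and the off-diagonal part. [folklore] -/
private theorem tsum_eq_diag_add_offdiag (T : ℕ → ℕ → ℂ) (S : Finset ℕ)
    (hsum : Summable (fun m : ℕ => ∑ n ∈ S.filter (fun n => n ≠ m), T m n)) :
    ∑' m : ℕ, ∑ n ∈ S, T m n = (∑ n ∈ S, T n n) + ∑' m : ℕ, ∑ n ∈ S.filter (fun n => n ≠ m), T m n := by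
  classical
  set dg : ℕ → ℂ := fun m => if m ∈ S then T m m else 0 with hdg
  have hsplit : ∀ m, ∑ n ∈ S, T m n = dg m + ∑ n ∈ S.filter (fun n => n ≠ m), T m n := by
    intro m
    rw [← Finset.sum_filter_add_sum_filter_not S (fun n => n = m)]
    congr 1
    by_cases hm : m ∈ S
    · rw [hdg]; simp only; rw [if_pos hm, Finset.filter_eq' S m, if_pos hm, Finset.sum_singleton]
    · rw [hdg]; simp only; rw [if_neg hm, Finset.filter_eq' S m, if_neg hm, Finset.sum_empty]
  have hdg_supp : ∀ m ∉ S, dg m = 0 := fun m hm => by rw [hdg]; exact if_neg hm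
  have hdg_sum : Summable dg := summable_of_ne_finset_zero hdg_supp
  have hdg_tsum : ∑' m, dg m = ∑ n ∈ S, T n n := by
    rw [tsum_eq_sum hdg_supp]
    exact Finset.sum_congr rfl fun m hm => by rw [hdg]; exact if_pos hm
  simp_rw [hsplit]
  rw [hdg_sum.tsum_add hsum, hdg_tsum]

/-- `e^{(1−𝓛₁²)/(4𝓛₂²)} ≤ e^{−𝓛⁹} = P⁻¹` for `𝓛 ≥ 5` (`𝓛₁ = 𝓛⁴⁰⁵`, `𝓛₂ = 𝓛⁴⁰⁰`:
`(1 − 𝓛⁸¹⁰)/(4𝓛⁸⁰⁰) ≤ −𝓛⁹` iff `𝓛⁸⁰⁹(𝓛 − 4) ≥ 1`). [cite: Zhang2022LandauSiegel, §2 (2.8), (2.15)] -/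
theorem exp_segment_error_le {D : ℕ} (hℓ : 5 ≤ ell D) :
    Real.exp ((1 - ell1 D ^ 2) / (4 * ell2 D ^ 2)) ≤ (bigP D)⁻¹ := by
  rw [bigP, ← Real.exp_neg]
  refine Real.exp_le_exp.mpr ?_
  have hℓ1 : 1 ≤ ell D := by linarith
  have h2 : 0 < 4 * ell2 D ^ 2 := by rw [ell2]; positivity
  rw [div_le_iff₀ h2, ell1, ell2, ← pow_mul, ← pow_mul]
  norm_num
  -- goal: `1 - ell D ^ 810 ≤ -ell D ^ 9 * (4 * ell D ^ 800)`, i.e. `4𝓛⁸⁰⁹ + 1 ≤ 𝓛⁸¹⁰`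
  have h809 : 1 ≤ ell D ^ 809 := one_le_pow₀ hℓ1
  have hkey : ell D ^ 9 * (4 * ell D ^ 800) = 4 * ell D ^ 809 := by ring
  have h810 : ell D ^ 810 = ell D ^ 809 * ell D := by ring
  nlinarith

/-- `(D⁴)^{1/4} = D`. [folklore] -/
private theorem rpow_four_quarter (D : ℕ) : (((D : ℝ) ^ 4) : ℝ) ^ (1 / 4 : ℝ) = D := by
  rw [← Real.rpow_natCast, ← Real.rpow_mul (Nat.cast_nonneg D)]; norm_num

end Book

/-! ## The four pieces, at a fixed modulus -/

section Pieces

variable {c' : ℝ} {D : ℕ} [NeZero D] (χ : DirichletCharacter ℂ D)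

/-- The bracket of the off-diagonal bound: `e^{1/(4𝓛₂²)} + (p−1)e^{−u₀(𝓛₂²u₀−1)} ≤ 4D⁴` for `p ∼ P`,
`𝓛 ≥ 2` (`u₀ = log(p/D⁴) ≥ 2`, so the second term is `≤ (p−1)·D⁴/p ≤ D⁴`; the first is `≤ e ≤ 3`).
[cite: Zhang2022LandauSiegel, §17 (17.3) p.96] -/
theorem offdiag_bracket_le (hℓ2 : 2 ≤ ell D) {p : ℕ} (hp : p ∈ primeWindow D) :
    1 * Real.exp (1 / (4 * ell2 D ^ 2)) + ((p : ℝ) - 1) *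
        Real.exp (-(Real.log ((p : ℝ) / ((D ^ 4 : ℕ) : ℝ)) *
          (ell2 D ^ 2 * Real.log ((p : ℝ) / ((D ^ 4 : ℕ) : ℝ)) - 1))) ≤ 4 * (D : ℝ) ^ 4 := by
  have hDpos : (0 : ℝ) < D := by exact_mod_cast Nat.pos_of_ne_zero (NeZero.ne D)
  have hD1 : (1 : ℝ) ≤ D := by exact_mod_cast Nat.pos_of_ne_zero (NeZero.ne D)
  have hp0 : (0 : ℝ) < p := pos_of_mem_primeWindow hp
  have hp1 : (0 : ℝ) ≤ (p : ℝ) - 1 := by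
    have : (1 : ℝ) ≤ p := by exact_mod_cast (prime_of_mem_primeWindow' hp).one_lt.le
    linarith
  have hL2' : 1 ≤ ell2 D ^ 2 := by rw [ell2]; exact one_le_pow₀ (one_le_pow₀ (by linarith))
  obtain ⟨_, hu2⟩ := pow_four_lt_and_log_ge hℓ2 hp
  have hD4eq : (((D ^ 4 : ℕ) : ℝ)) = (D : ℝ) ^ 4 := by push_cast; ring
  have hexp1 : Real.exp (1 / (4 * ell2 D ^ 2)) ≤ 3 := by
    have h1 : 1 / (4 * ell2 D ^ 2) ≤ 1 := by rw [div_le_one (by positivity)]; nlinarith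
    exact (Real.exp_le_exp.mpr h1).trans (le_of_lt (lt_trans Real.exp_one_lt_d9 (by norm_num)))
  rw [hD4eq]
  set u : ℝ := Real.log ((p : ℝ) / (D : ℝ) ^ 4) with hu
  have hu0 : 0 ≤ u := by linarith
  have h2u : 2 ≤ ell2 D ^ 2 * u := le_trans hu2 (le_mul_of_one_le_left hu0 hL2')
  have hle : Real.exp (-(u * (ell2 D ^ 2 * u - 1))) ≤ Real.exp (-u) :=
    Real.exp_le_exp.mpr (by nlinarith)
  have h3 : Real.exp (-u) = (D : ℝ) ^ 4 / p := by
    rw [hu, Real.exp_neg, Real.exp_log (div_pos hp0 (pow_pos hDpos 4)), inv_div]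
  have hexp2 : ((p : ℝ) - 1) * Real.exp (-(u * (ell2 D ^ 2 * u - 1))) ≤ (D : ℝ) ^ 4 := by
    calc ((p : ℝ) - 1) * Real.exp (-(u * (ell2 D ^ 2 * u - 1)))
        ≤ ((p : ℝ) - 1) * Real.exp (-u) := mul_le_mul_of_nonneg_left hle hp1
      _ = ((p : ℝ) - 1) / p * (D : ℝ) ^ 4 := by rw [h3]; ring
      _ ≤ 1 * (D : ℝ) ^ 4 := by
          refine mul_le_mul_of_nonneg_right ?_ (by positivity)
          rw [div_le_one hp0]; linarith
      _ = (D : ℝ) ^ 4 := one_mul _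
  have h3' : (3 : ℝ) ≤ 3 * (D : ℝ) ^ 4 := by nlinarith [one_le_pow₀ (n := 4) hD1]
  linarith only [hexp1, hexp2, h3']

/-- **The extra diagonal term at `n = D⁴` is `o(p)`**: `(#Σ*)·|ν*(D⁴)||ν(D⁴)|/D⁴ ≤ p·CC_δ/D²` under
`|ν*(n)| ≤ Cn^{1/4}` and the divisor bound `τ₂(n) ≤ C_δn^{1/4}` (`(D⁴)^{1/4} = D`).
[cite: Zhang2022LandauSiegel, §17 (17.3) p.96] -/
theorem extra_term_le {p : ℕ} (hp : p ∈ primeWindow D) {C Cd : ℝ}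
    (hC : ∀ n : ℕ, ‖nuStar c' χ n‖ ≤ C * (n : ℝ) ^ (1 / 4 : ℝ))
    (hCd : ∀ n : ℕ, (n.divisors.card : ℝ) ≤ Cd * (n : ℝ) ^ (1 / 4 : ℝ)) :
    ((chrMod D p).card : ℝ) * ‖nuStar c' χ (D ^ 4) * nu χ (D ^ 4) / ((D ^ 4 : ℕ) : ℂ)‖ ≤
      (p : ℝ) * (C * Cd) / (D : ℝ) ^ 2 := by
  have hDpos : (0 : ℝ) < D := by exact_mod_cast Nat.pos_of_ne_zero (NeZero.ne D)
  have hp0 : (0 : ℝ) < p := pos_of_mem_primeWindow hp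
  have hC0 : 0 ≤ C := by
    have := hC 1; simp at this; exact (norm_nonneg _).trans this
  have hcast : (((D ^ 4 : ℕ) : ℝ)) = (D : ℝ) ^ 4 := by push_cast; ring
  have hcard_le : ((chrMod D p).card : ℝ) ≤ p := by
    rw [Phi3TermByTerm.card_chrMod hp]
    exact_mod_cast Nat.sub_le p 2
  have hν : ‖nu χ (D ^ 4)‖ ≤ Cd * D := by
    rw [show nu χ (D ^ 4) = divisorSumChar χ (D ^ 4) from rfl]
    refine (Literature.NumberTheory.LFunctions.norm_divisorSumChar_le χ (D ^ 4)).trans ?_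
    have := hCd (D ^ 4)
    rwa [hcast, rpow_four_quarter] at this
  have hνs : ‖nuStar c' χ (D ^ 4)‖ ≤ C * D := by
    have := hC (D ^ 4)
    rwa [hcast, rpow_four_quarter] at this
  rw [norm_div, norm_mul, Complex.norm_natCast, hcast]
  have hD4pos : (0 : ℝ) < (D : ℝ) ^ 4 := by positivity
  calc ((chrMod D p).card : ℝ) * (‖nuStar c' χ (D ^ 4)‖ * ‖nu χ (D ^ 4)‖ / (D : ℝ) ^ 4)
      ≤ (p : ℝ) * ((C * D) * (Cd * D) / (D : ℝ) ^ 4) := by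
        refine mul_le_mul hcard_le ?_ (by positivity) hp0.le
        exact div_le_div_of_nonneg_right (mul_le_mul hνs hν (norm_nonneg _) (by positivity))
          hD4pos.le
    _ = (p : ℝ) * (C * Cd) / (D : ℝ) ^ 2 := by field_simp

end Pieces

/-! ## (17.3) -/

section Main

/-- **(17.3) is a theorem of the tree**: for every `c′`, `Typed.Section17.Eq17_3 c′` — for all large
`D`, every real primitive `χ` with (A) [not used], every `p ∼ P`:
`‖Φ₃⁺(p) − p·Σ_{1≤n<D⁴}ν*(n)ν(n)/n‖ ≤ εp`. Assembly: `Φ₃⁺ − pS = (Φ₃⁺ − ΣΣ_{n≤D⁴}) + off-diagonal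
− 2S + (p−2)ν*(D⁴)ν(D⁴)/D⁴`, the four pieces being `≤ p·CZD¹⁰e^{−𝓛⁹}`, `≤ 4CZD¹⁴`, `≤ 2CD⁵` and
`≤ pCC_δD^{−2}`, each `≤ εp/4` for large `D`. [cite: Zhang2022LandauSiegel, §17 (17.3) p.96] -/
theorem eq17_3_holds (c' : ℝ) : Eq17_3 c' := by
  intro ε hε
  obtain ⟨C, hC⟩ := nuStar_bound c'
  obtain ⟨Cd, hCd1, hCd⟩ := Sieve.exists_card_divisors_le_mul_rpow' (by norm_num : (0 : ℝ) < 1 / 4)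
  set Z : ℝ := ∑' m : ℕ, (m : ℝ) ^ (-(5 / 4 : ℝ)) with hZ
  have hZ0 : 0 ≤ Z := tsum_nonneg fun m => by positivity
  have hε4 : 0 < ε / 4 := by positivity
  -- thresholds
  obtain ⟨D₀, hall⟩ := ((((hC.and (forAllLarge_le_ell 5)).and
    (forAllLarge_const_mul_pow_le (C * Z) hε4 10)).and
    (forAllLarge_const_mul_pow_le (4 * C * Z) hε4 14)).and
    (forAllLarge_const_mul_pow_le (2 * C) hε4 5)).and
    (forAllLarge_le_ell (4 * C * Cd / ε))
  refine ⟨D₀, fun D _ χ hD hq hprim _hA p hp => ?_⟩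
  obtain ⟨⟨⟨⟨⟨eC, hℓ5⟩, hP10⟩, hP14⟩, hP5⟩, hℓC⟩ := hall D χ hD hq hprim
  -- basic facts at this modulus
  have hC0 : 0 ≤ C := by
    have := eC 1; simp at this; exact (norm_nonneg _).trans this
  have hℓ2 : 2 ≤ ell D := by linarith
  have hD2 : 2 ≤ D := by
    by_contra h
    have hD1' : (D : ℝ) ≤ 1 := by exact_mod_cast (show D ≤ 1 by omega)
    have : ell D ≤ 0 := Real.log_nonpos (Nat.cast_nonneg D) hD1'
    linarith
  have hDpos : (0 : ℝ) < D := by exact_mod_cast (show 0 < D by omega)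
  have hP : bigP D < p := bigP_lt_of_mem_primeWindow hp
  have hP0 : 0 < bigP D := bigP_pos D
  have hp0 : (0 : ℝ) < p := pos_of_mem_primeWindow hp
  obtain ⟨hD4p, hu2⟩ := pow_four_lt_and_log_ge hℓ2 hp
  have hD4nat : D ^ 4 < p := by exact_mod_cast (show ((D ^ 4 : ℕ) : ℝ) < p by push_cast; exact hD4p)
  have hD4eq : (((D ^ 4 : ℕ) : ℝ)) = (D : ℝ) ^ 4 := by push_cast; ring
  have hL2' : 1 ≤ ell2 D ^ 2 := by rw [ell2]; exact one_le_pow₀ (one_le_pow₀ (by linarith))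
  have hu₀ : 1 ≤ ell2 D ^ 2 * Real.log ((p : ℝ) / (D ^ 4 : ℕ)) := by rw [hD4eq]; nlinarith
  have hSIcc : ∀ n ∈ Finset.Icc 1 (D ^ 4), n ≠ 0 ∧ n ≤ D ^ 4 := fun n hn => by
    rw [Finset.mem_Icc] at hn; exact ⟨by omega, hn.2⟩
  -- names
  set S : ℂ := ∑ n ∈ Finset.Ico 1 (D ^ 4), nuStar c' χ n * nu χ n / (n : ℂ) with hSdef
  set t : ℂ := nuStar c' χ (D ^ 4) * nu χ (D ^ 4) / ((D ^ 4 : ℕ) : ℂ) with htdef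
  set A₀ : ℝ := ∑' m : ℕ, ‖LSeries.term (nuStar c' χ) (3 / 2 : ℂ) m‖ with hA₀
  set B₀ : ℝ := ∑ n ∈ Finset.Icc 1 (D ^ 4), ‖nu χ n‖ * Real.sqrt n with hB₀
  have hA₀le : A₀ ≤ C * Z := tsum_norm_term_nuStar_le χ eC
  have hA₀0 : 0 ≤ A₀ := tsum_nonneg fun _ => norm_nonneg _
  have hB₀le : B₀ ≤ (D : ℝ) ^ 10 := Phi3TermByTerm.sum_norm_nu_mul_sqrt_le χ
  have hB₀0 : 0 ≤ B₀ := Finset.sum_nonneg fun n _ => by positivity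
  have hcard_le : ((chrMod D p).card : ℝ) ≤ p := by
    rw [Phi3TermByTerm.card_chrMod hp]; exact_mod_cast Nat.sub_le p 2
  -- (1) the term-by-term error
  have h1 : ‖Phi3plus c' χ p - ∑' m : ℕ, ∑ n ∈ Finset.Icc 1 (D ^ 4), term_u005 c' χ p m n‖ ≤
      ε / 4 * p := by
    have h := Phi3TermByTerm.norm_Phi3plus_sub_tsum_le c' χ hD2 p
    rw [← hA₀, ← hB₀] at h
    refine h.trans ?_
    have hE := exp_segment_error_le hℓ5
    have hE0 : 0 ≤ Real.exp ((1 - ell1 D ^ 2) / (4 * ell2 D ^ 2)) := Real.exp_nonneg _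
    calc ((chrMod D p).card : ℝ) * A₀ * B₀ * Real.exp ((1 - ell1 D ^ 2) / (4 * ell2 D ^ 2))
        ≤ (p : ℝ) * (C * Z) * (D : ℝ) ^ 10 * (bigP D)⁻¹ :=
          mul_le_mul (mul_le_mul (mul_le_mul hcard_le hA₀le hA₀0 hp0.le) hB₀le hB₀0
            (by positivity)) hE hE0 (by positivity)
      _ = (p : ℝ) * ((C * Z * (D : ℝ) ^ 10) * (bigP D)⁻¹) := by ring
      _ ≤ (p : ℝ) * (ε / 4 * bigP D * (bigP D)⁻¹) :=
          mul_le_mul_of_nonneg_left (mul_le_mul_of_nonneg_right hP10 (by positivity)) hp0.le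
      _ = ε / 4 * p := by field_simp
  -- (2) the off-diagonal part
  obtain ⟨hsum, hoff⟩ := Phi3TermByTerm.norm_offDiagonal_term_u005_le c' χ hD2 hp hD4nat hu₀ hSIcc
  have h2 : ‖∑' m : ℕ, ∑ n ∈ (Finset.Icc 1 (D ^ 4)).filter (fun n => n ≠ m), term_u005 c' χ p m n‖ ≤
      ε / 4 * p := by
    rw [← hA₀, ← hB₀] at hoff
    refine hoff.trans ?_
    have hfac := offdiag_bracket_le hℓ2 hp
    have hBr0 : 0 ≤ 1 * Real.exp (1 / (4 * ell2 D ^ 2)) + ((p : ℝ) - 1) *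
        Real.exp (-(Real.log ((p : ℝ) / ((D ^ 4 : ℕ) : ℝ)) *
          (ell2 D ^ 2 * Real.log ((p : ℝ) / ((D ^ 4 : ℕ) : ℝ)) - 1))) := by
      have hp1 : (0 : ℝ) ≤ (p : ℝ) - 1 := by
        have : (1 : ℝ) ≤ p := by exact_mod_cast (prime_of_mem_primeWindow' hp).one_lt.le
        linarith
      exact add_nonneg (by positivity) (mul_nonneg hp1 (Real.exp_nonneg _))
    have hCZD : 0 ≤ C * Z * (D : ℝ) ^ 10 := by positivity
    have hCZ : 0 ≤ C * Z := mul_nonneg hC0 hZ0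
    refine (mul_le_mul (mul_le_mul hA₀le hB₀le hB₀0 hCZ) hfac hBr0 (by positivity)).trans ?_
    calc C * Z * (D : ℝ) ^ 10 * (4 * (D : ℝ) ^ 4) = 4 * C * Z * (D : ℝ) ^ 14 := by ring
      _ ≤ ε / 4 * bigP D := hP14
      _ ≤ ε / 4 * p := mul_le_mul_of_nonneg_left hP.le hε4.le
  -- (3) the diagonal over `n ≤ D⁴` is `#Σ* · (S + t)`
  have hdiag : ∑ n ∈ Finset.Icc 1 (D ^ 4), term_u005 c' χ p n n =
      ((chrMod D p).card : ℂ) * (S + t) := by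
    have hterm : ∀ n ∈ Finset.Icc 1 (D ^ 4), term_u005 c' χ p n n =
        ((chrMod D p).card : ℂ) * (nuStar c' χ n * nu χ n / (n : ℂ)) := by
      intro n hn
      rw [Finset.mem_Icc] at hn
      exact Phi3TermByTerm.term_u005_diag c' χ p hn.1 (by omega)
    rw [Finset.sum_congr rfl hterm, ← Finset.mul_sum, hSdef, htdef]
    congr 1
    have h14 : 1 ≤ D ^ 4 := Nat.one_le_pow _ _ (by omega)
    rw [← Finset.Ico_insert_right h14, Finset.sum_insert Finset.right_notMem_Ico, add_comm]
  have hsplit := tsum_eq_diag_add_offdiag (term_u005 c' χ p) (Finset.Icc 1 (D ^ 4)) hsum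
  rw [hdiag] at hsplit
  -- (4) sizes of `S` and of the extra term `#Σ* · t`
  have h3 : ‖(2 : ℂ) * S‖ ≤ ε / 4 * p := by
    rw [norm_mul, Complex.norm_two]
    calc 2 * ‖S‖ ≤ 2 * (C * (D : ℝ) ^ 5) := by
          refine mul_le_mul_of_nonneg_left ?_ (by norm_num)
          rw [hSdef]; exact norm_diagSum_le χ eC
      _ = 2 * C * (D : ℝ) ^ 5 := by ring
      _ ≤ ε / 4 * bigP D := hP5
      _ ≤ ε / 4 * p := mul_le_mul_of_nonneg_left hP.le hε4.le
  have h4 : ‖((chrMod D p).card : ℂ) * t‖ ≤ ε / 4 * p := by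
    rw [norm_mul, Complex.norm_natCast, htdef]
    refine (extra_term_le χ hp eC hCd).trans ?_
    have hCCd : C * Cd ≤ ε / 4 * ell D := by
      have h := hℓC
      rw [div_le_iff₀ hε] at h
      linarith
    have hℓD : ell D ≤ (D : ℝ) ^ 2 := by
      have h1 : ell D ≤ D := (Real.log_le_sub_one_of_pos hDpos).trans (by linarith)
      nlinarith
    have hD2pos : (0 : ℝ) < (D : ℝ) ^ 2 := by positivity
    rw [div_le_iff₀ hD2pos]
    calc (p : ℝ) * (C * Cd) ≤ (p : ℝ) * (ε / 4 * ell D) := mul_le_mul_of_nonneg_left hCCd hp0.le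
      _ ≤ (p : ℝ) * (ε / 4 * (D : ℝ) ^ 2) := by gcongr
      _ = ε / 4 * p * (D : ℝ) ^ 2 := by ring
  -- assemble: `Φ₃⁺ − pS = (Φ₃⁺ − ΣΣ) + off − 2S + #Σ*·t`
  have hid : Phi3plus c' χ p - (p : ℂ) * S =
      (Phi3plus c' χ p - ∑' m : ℕ, ∑ n ∈ Finset.Icc 1 (D ^ 4), term_u005 c' χ p m n) +
        (∑' m : ℕ, ∑ n ∈ (Finset.Icc 1 (D ^ 4)).filter (fun n => n ≠ m), term_u005 c' χ p m n) -
        2 * S + ((chrMod D p).card : ℂ) * t := by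
    have hcardC : ((chrMod D p).card : ℂ) = (p : ℂ) - 2 := by
      rw [Phi3TermByTerm.card_chrMod hp]
      have h2 : 2 ≤ p := (prime_of_mem_primeWindow' hp).two_le
      push_cast [Nat.cast_sub h2]; ring
    rw [hsplit, hcardC]; ring
  rw [hid]
  calc ‖(Phi3plus c' χ p - ∑' m : ℕ, ∑ n ∈ Finset.Icc 1 (D ^ 4), term_u005 c' χ p m n) +
        (∑' m : ℕ, ∑ n ∈ (Finset.Icc 1 (D ^ 4)).filter (fun n => n ≠ m), term_u005 c' χ p m n) -
        2 * S + ((chrMod D p).card : ℂ) * t‖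
      ≤ ‖Phi3plus c' χ p - ∑' m : ℕ, ∑ n ∈ Finset.Icc 1 (D ^ 4), term_u005 c' χ p m n‖ +
        ‖∑' m : ℕ, ∑ n ∈ (Finset.Icc 1 (D ^ 4)).filter (fun n => n ≠ m), term_u005 c' χ p m n‖ +
        ‖(2 : ℂ) * S‖ + ‖((chrMod D p).card : ℂ) * t‖ := by
          refine (norm_add_le _ _).trans (add_le_add ?_ le_rfl)
          exact (norm_sub_le _ _).trans (add_le_add (norm_add_le _ _) le_rfl)
    _ ≤ ε / 4 * p + ε / 4 * p + ε / 4 * p + ε / 4 * p :=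
        add_le_add (add_le_add (add_le_add h1 h2) h3) h4
    _ = ε * p := by ring

variable (c' : ℝ) in
/-- `Eq17_3` — `_holds` alias of `eq17_3_holds` above under the fact's exact name, stated under the
prover's own binders as section variables (appended 2026-08-28, D-0026 bookkeeping: the proof term is the
existing theorem of this file; no statement, definition or attribute is edited; no new named fact; the
ledger's debt table listed the fact unproved). [cite: Zhang2022LandauSiegel, §17 (17.3) p.96] -/
theorem _root_.Literature.NumberTheory.LFunctions.Zhang2022.Typed.Section17.Eq17_3_holds :
    _root_.Literature.NumberTheory.LFunctions.Zhang2022.Typed.Section17.Eq17_3 c' :=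
  _root_.Literature.NumberTheory.LFunctions.Zhang2022.Phi3Eval.eq17_3_holds (c' := c')

end Main

end Literature.NumberTheory.LFunctions.Zhang2022.Phi3Eval
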